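import Summits.HubbardSuperconductivity.HubbardSuperconductivity.Theses.InfiniteVolumeFirst
import Summits.HubbardSuperconductivity.HubbardSuperconductivity.Theorems.WindowInfraredBound.Negative.NearGroundStates
import Literature.Barriers.HubbardSuperconductivity.PureModelStripeCompetitionProofs

/-!
# Crux `NoInfraredPileUp` (stmt-HubbardSuperconductivity-18534), negative side:
# the SOFT window tightness, too, needs the ground-state property at `O(1)` TOTAL energy resolution

`not_noInfraredPileUpNearGroundStates_of_weakCouplingLRO`.  The soft (rate-free, weak-coupling)
tightness crux of route `InfiniteVolumeFirst` becomes FALSE as soon as its hypothesis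
`IsGroundStateInSector H_L N_L 0 (ψ L)` is relaxed to "unit vector of the sector with energy
`Re ⟨ψ, Hψ⟩ ≤ minEnergyOn + 8π²`", PROVIDED that at some doping `δ` and at arbitrarily weak coupling
some ground-state family carries `d`-wave pair long-range order `‖Δ_d ψ_L‖² ≥ a L⁴` along the large
even sides — i.e. exactly in the regime in which the route wants to USE the crux (its rank-2 crux
`NoNormalLimitState` plus the exchange place the argument in an ordered phase).

WITNESS (the tree's Lieb–Schultz–Mattis twist lemmas, `…/WindowInfraredBound/Negative/NearGroundStatesTwist`):
the twisted ground state `G_j ψ_L` (`exists_twist_energy_le`: energy `≤ E₀ + 8π²`) carries the zero-mode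
condensate to the window momentum `|q| = 4π/L` intact up to `O(L)` (`re_pairFieldAt_twist_ge`:
`S(−2jê₁) ≥ aL²/2 − 32π²`), so at `η = a/8` no `ε, L₀` can work.  Reading: no argument using only
"energy within `O(1)` of the ground energy" (variational closeness, approximate ground states,
energy-DENSITY information of any precision, infinite-volume ground-state / KMS characterisations,
which see only `o(L²)`) can prove the crux where the route needs it; in the ordered phase the crux is
a statement about EXACT eigenvectors at the bottom of the tower of states (phase rigidity of the
condensate at the longest wavelength).  Weak coupling changes the prefactor `a`, not the resolution.
Strategist evidence for `STRATEGY-CENSUS.md` (planner-cstrat-stmt-HubbardSuperconductivity-18534-b1-0).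
Sources: Lieb–Schultz–Mattis, Ann. Phys. 16 (1961) 407; H. Watanabe, J. Stat. Phys. 177 (2019) 717
§2.2.1; H. Tasaki (2020) §2.1; D. J. Scalapino, Phys. Rep. 250 (1995) 329 §2.
-/

set_option linter.dupNamespace false

noncomputable section

namespace Summit.HubbardSuperconductivity.HubbardSuperconductivity.Theorems.NoInfraredPileUp.Negative

open Literature.MathematicalPhysics.QuantumLattice Literature.MathematicalPhysics.QuantumFieldTheory
  Literature.Probability.LatticeModels Literature.Hubbard Literature.Barriers.HubbardSuperconductivity Matrix Finset
open Summit.HubbardSuperconductivity.HubbardSuperconductivity.Theorems.WindowInfraredBound.Negative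
open scoped Matrix.Norms.L2Operator ComplexOrder ComplexConjugate

/-- The soft crux `InfiniteVolumeFirst.NoInfraredPileUp` with its ground-state hypothesis relaxed to
"unit vector of the `(N_L, 0)` sector within `8π²` of the sector ground energy" (everything else
verbatim). [folklore] -/
def NoInfraredPileUpNearGroundStates : Prop :=
  ∀ δ ∈ Set.Ioo (0:ℝ) (1 / 2), ∃ U₁ : ℝ, 0 < U₁ ∧ ∀ U ∈ Set.Ioo (0:ℝ) U₁,
    ∀ (N : ℕ → ℕ) (ψ : ∀ L, Fock (Orb (FermionTorus 2 L))),
      (∀ L, Even L → N L = 2 * ⌊(1 - δ) * (L : ℝ) ^ 2 / 2⌋₊ ∧ star (ψ L) ⬝ᵥ ψ L = 1 ∧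
          ψ L ∈ szSector (Λ := FermionTorus 2 L) (N L) 0 ∧
          (star (ψ L) ⬝ᵥ (hubbardTorus 2 L 1 U *ᵥ ψ L)).re ≤
            (hubbardTorus 2 L 1 U).minEnergyOn (szSector (Λ := FermionTorus 2 L) (N L) 0) +
              8 * Real.pi ^ 2) →
        ∀ η : ℝ, 0 < η → ∃ ε : ℝ, 0 < ε ∧ ∃ L₀ : ℕ, ∀ (L : ℕ) [NeZero L], Even L → L₀ ≤ L →
          (∑ m : Fin 2 → ZMod L, if m ≠ 0 ∧ momentumNormSq L m ≤ ε ^ 2 then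
              pairStructureFactor dWaveFormFactor L (ψ L) m else 0) ≤ η * (L : ℝ) ^ 2

/-- **The soft tightness needs the ground-state property at `O(1)` total energy resolution.**
If at some `δ ∈ (0,1/2)`, for every `U₁ > 0`, some `U ∈ (0, U₁)` has a ground-state family with
`d`-wave pair LRO `a L⁴ ≤ Re ⟨Δ_dψ_L, Δ_dψ_L⟩` along the large even sides, then
`NoInfraredPileUpNearGroundStates` is false: the LSM-twisted ground states are admissible for it
and have `Σ_{0<|q_m|≤ε} S(m) ≥ S(∓2ê₁) ≥ aL²/2 − 32π² > (a/8)L²` at every `ε` once `L ≥ 4π/ε`,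
`L² ≥ 128π²/a`. Lieb–Schultz–Mattis (1961); Watanabe (2019) §2.2.1; Scalapino (1995) §2. [folklore] -/
theorem not_noInfraredPileUpNearGroundStates_of_weakCouplingLRO
    (hLRO : ∃ δ ∈ Set.Ioo (0:ℝ) (1 / 2), ∀ U₁ : ℝ, 0 < U₁ → ∃ U ∈ Set.Ioo (0:ℝ) U₁,
      ∃ a : ℝ, 0 < a ∧ ∃ L₁ : ℕ, ∀ (L : ℕ) [NeZero L], L₁ ≤ L → Even L →
        ∃ ψ : Fock (Orb (FermionTorus 2 L)), star ψ ⬝ᵥ ψ = 1 ∧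
          IsGroundStateInSector (hubbardTorus 2 L 1 U) (2 * ⌊(1 - δ) * (L : ℝ) ^ 2 / 2⌋₊) 0 ψ ∧
          a * (L : ℝ) ^ 4 ≤
            (star (pairField dWaveFormFactor L *ᵥ ψ) ⬝ᵥ (pairField dWaveFormFactor L *ᵥ ψ)).re) :
    ¬ NoInfraredPileUpNearGroundStates := by
  intro h
  obtain ⟨δ, hδ, hL⟩ := hLRO
  obtain ⟨U₁, hU₁, hB⟩ := h δ hδ
  obtain ⟨U, hU, a, ha, L₁, hGS⟩ := hL U₁ hU₁
  have hδ1 : (-1 : ℝ) ≤ δ := by linarith [hδ.1]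
  have h8 : (0 : ℝ) ≤ 8 * Real.pi ^ 2 := by positivity
  -- Step 1: the witness family at the sides `n + 1`
  have key : ∀ n : ℕ, ∃ φ : Fock (Orb (FermionTorus 2 (n + 1))),
      (star φ ⬝ᵥ φ = 1 ∧
        φ ∈ szSector (Λ := FermionTorus 2 (n + 1)) (2 * ⌊(1 - δ) * ((n + 1 : ℕ) : ℝ) ^ 2 / 2⌋₊) 0 ∧
        (star φ ⬝ᵥ (hubbardTorus 2 (n + 1) 1 U *ᵥ φ)).re ≤
          (hubbardTorus 2 (n + 1) 1 U).minEnergyOn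
            (szSector (Λ := FermionTorus 2 (n + 1)) (2 * ⌊(1 - δ) * ((n + 1 : ℕ) : ℝ) ^ 2 / 2⌋₊) 0) +
            8 * Real.pi ^ 2) ∧
      (L₁ ≤ n + 1 → Even (n + 1) → 6 ≤ n + 1 →
        ∃ m₀ : TorusSite 2 (n + 1), m₀ ≠ 0 ∧ m₀ 1 = 0 ∧ (((m₀ 0).valMinAbs : ℤ) : ℝ) ^ 2 = 4 ∧
          a * ((n + 1 : ℕ) : ℝ) ^ 2 / 2 - 32 * Real.pi ^ 2 ≤
            pairStructureFactor dWaveFormFactor (n + 1) φ m₀) := by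
    intro n
    by_cases hc : L₁ ≤ n + 1 ∧ Even (n + 1) ∧ 6 ≤ n + 1
    · obtain ⟨ψ, hψ1, hψGS, hψa⟩ := hGS (n + 1) hc.1 hc.2.1
      have hL3 : 3 ≤ n + 1 := by omega
      have hL6 : 6 ≤ n + 1 := hc.2.2
      obtain ⟨j, hj, hjE⟩ := exists_twist_energy_le hL3 U hψ1
      have hGu : ∀ v, (phaseGauge fun u : FermionTorus 2 (n + 1) =>
            twistGauge (n + 1) (j * (2 * Real.pi)) u.toTorusSite)ᴴ *ᵥ
          (phaseGauge (fun u : FermionTorus 2 (n + 1) =>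
            twistGauge (n + 1) (j * (2 * Real.pi)) u.toTorusSite) *ᵥ v) = v :=
        conjTranspose_phaseGauge_mulVec_phaseGauge_mulVec _
      have hφ1 : star (phaseGauge (fun u : FermionTorus 2 (n + 1) =>
            twistGauge (n + 1) (j * (2 * Real.pi)) u.toTorusSite) *ᵥ ψ) ⬝ᵥ
          (phaseGauge (fun u : FermionTorus 2 (n + 1) =>
            twistGauge (n + 1) (j * (2 * Real.pi)) u.toTorusSite) *ᵥ ψ) = 1 := by
        rw [star_mulVec_dotProduct_self_of_unitary hGu, hψ1]
      have hφmem := phaseGauge_mulVec_mem_szSector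
        (fun u : FermionTorus 2 (n + 1) => twistGauge (n + 1) (j * (2 * Real.pi)) u.toTorusSite) hψGS.1
      have hE0 : (star ψ ⬝ᵥ (hubbardTorus 2 (n + 1) 1 U *ᵥ ψ)).re =
          (hubbardTorus 2 (n + 1) 1 U).minEnergyOn
            (szSector (Λ := FermionTorus 2 (n + 1)) (2 * ⌊(1 - δ) * ((n + 1 : ℕ) : ℝ) ^ 2 / 2⌋₊) 0) := by
        rw [hψGS.2.2, dotProduct_smul, hψ1, smul_eq_mul, mul_one, Complex.ofReal_re]
      have hφE : (star (phaseGauge (fun u : FermionTorus 2 (n + 1) =>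
            twistGauge (n + 1) (j * (2 * Real.pi)) u.toTorusSite) *ᵥ ψ) ⬝ᵥ
          (hubbardTorus 2 (n + 1) 1 U *ᵥ
            (phaseGauge (fun u : FermionTorus 2 (n + 1) =>
              twistGauge (n + 1) (j * (2 * Real.pi)) u.toTorusSite) *ᵥ ψ))).re ≤
          (hubbardTorus 2 (n + 1) 1 U).minEnergyOn
            (szSector (Λ := FermionTorus 2 (n + 1)) (2 * ⌊(1 - δ) * ((n + 1 : ℕ) : ℝ) ^ 2 / 2⌋₊) 0) +
            8 * Real.pi ^ 2 := by
        rw [← hE0]; exact hjE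
      -- the window momentum `m₀ = −2jê₁`
      obtain ⟨m₀, hm₀⟩ : ∃ m₀ : TorusSite 2 (n + 1), m₀ = -(Pi.single 0 (((2 * j : ℤ)) : ZMod (n + 1))) :=
        ⟨_, rfl⟩
      have hm₀1 : m₀ 1 = 0 := by
        rw [hm₀, Pi.neg_apply, Pi.single_eq_of_ne (by decide : (1 : Fin 2) ≠ 0), neg_zero]
      have hval : (((m₀ 0).valMinAbs : ℤ) : ℝ) ^ 2 = 4 := by
        have h2 : ((2 : ℕ) : ZMod (n + 1)).valMinAbs = (2 : ℕ) :=
          ZMod.valMinAbs_natCast_of_le_half (by omega)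
        rcases hj with rfl | rfl
        · have hm : m₀ 0 = -((2 : ℕ) : ZMod (n + 1)) := by
            rw [hm₀, Pi.neg_apply, Pi.single_eq_same]; push_cast; ring
          have hne : 2 * ((2 : ℕ) : ZMod (n + 1)).val ≠ n + 1 := by
            rw [ZMod.val_natCast, Nat.mod_eq_of_lt (by omega)]; omega
          rw [hm, ZMod.valMinAbs_neg_of_ne_half hne, h2]; push_cast; norm_num
        · have hm : m₀ 0 = ((2 : ℕ) : ZMod (n + 1)) := by
            rw [hm₀, Pi.neg_apply, Pi.single_eq_same]; push_cast; ring
          rw [hm, h2]; push_cast; norm_num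
      have hm₀ne : m₀ ≠ 0 := by
        intro h0
        have h2 : (((m₀ 0).valMinAbs : ℤ) : ℝ) ^ 2 = 0 := by
          rw [h0, Pi.zero_apply, ZMod.valMinAbs_zero]; norm_num
        linarith
      have hS : a * ((n + 1 : ℕ) : ℝ) ^ 2 / 2 - 32 * Real.pi ^ 2 ≤ pairStructureFactor dWaveFormFactor (n + 1)
          (phaseGauge (fun u : FermionTorus 2 (n + 1) =>
            twistGauge (n + 1) (j * (2 * Real.pi)) u.toTorusSite) *ᵥ ψ) m₀ := by
        have h := re_pairFieldAt_twist_ge hL3 hj hψ1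
        rw [← hm₀] at h
        have hL2 : (0 : ℝ) < ((n + 1 : ℕ) : ℝ) ^ 2 := by positivity
        rw [pairStructureFactor_apply, le_div_iff₀ hL2]
        have h' : a * ((n + 1 : ℕ) : ℝ) ^ 4 / 2 - 32 * Real.pi ^ 2 * ((n + 1 : ℕ) : ℝ) ^ 2 ≤
            (star (pairField dWaveFormFactor (n + 1) *ᵥ ψ) ⬝ᵥ (pairField dWaveFormFactor (n + 1) *ᵥ ψ)).re / 2 -
              32 * Real.pi ^ 2 * ((n + 1 : ℕ) : ℝ) ^ 2 := by linarith
        calc (a * ((n + 1 : ℕ) : ℝ) ^ 2 / 2 - 32 * Real.pi ^ 2) * ((n + 1 : ℕ) : ℝ) ^ 2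
            = a * ((n + 1 : ℕ) : ℝ) ^ 4 / 2 - 32 * Real.pi ^ 2 * ((n + 1 : ℕ) : ℝ) ^ 2 := by ring
          _ ≤ _ := h'.trans h
      exact ⟨_, ⟨hφ1, hφmem, hφE⟩, fun _ _ _ => ⟨m₀, hm₀ne, hm₀1, hval, hS⟩⟩
    · obtain ⟨ψ, hψ1, hψGS⟩ := exists_unit_isGroundStateInSector_hubbardTorus U (n + 1) _
        (natFloor_filling_le_sq hδ1 (n + 1))
      refine ⟨ψ, ⟨hψ1, hψGS.1, ?_⟩, fun h1 h2 h3 => (hc ⟨h1, h2, h3⟩).elim⟩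
      rw [hψGS.2.2, dotProduct_smul, hψ1, smul_eq_mul, mul_one, Complex.ofReal_re]
      linarith
  choose φ₁ hφ₁ using key
  -- the side-`0` ground state and the family
  obtain ⟨φ00, hφ00, hφ00GS⟩ := exists_unit_isGroundStateInSector_hubbardTorus U 0 _
    (natFloor_filling_le_sq hδ1 0)
  obtain ⟨φ, hφ0, hφs⟩ : ∃ φ : ∀ L, Fock (Orb (FermionTorus 2 L)), φ 0 = φ00 ∧ ∀ n, φ (n + 1) = φ₁ n :=
    ⟨fun L => match L with
      | 0 => φ00
      | n + 1 => φ₁ n, rfl, fun _ => rfl⟩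
  -- Step 2: admissibility of the family for the relaxed crux
  have hadm : ∀ L, Even L → (fun L : ℕ => 2 * ⌊(1 - δ) * (L : ℝ) ^ 2 / 2⌋₊) L =
        2 * ⌊(1 - δ) * (L : ℝ) ^ 2 / 2⌋₊ ∧ star (φ L) ⬝ᵥ φ L = 1 ∧
      φ L ∈ szSector (Λ := FermionTorus 2 L) ((fun L : ℕ => 2 * ⌊(1 - δ) * (L : ℝ) ^ 2 / 2⌋₊) L) 0 ∧
      (star (φ L) ⬝ᵥ (hubbardTorus 2 L 1 U *ᵥ φ L)).re ≤
        (hubbardTorus 2 L 1 U).minEnergyOn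
          (szSector (Λ := FermionTorus 2 L) ((fun L : ℕ => 2 * ⌊(1 - δ) * (L : ℝ) ^ 2 / 2⌋₊) L) 0) +
          8 * Real.pi ^ 2 := by
    intro L _
    refine ⟨rfl, ?_⟩
    cases L with
    | zero =>
      rw [hφ0]
      refine ⟨hφ00, hφ00GS.1, ?_⟩
      simp only
      rw [hφ00GS.2.2, dotProduct_smul, hφ00, smul_eq_mul, mul_one, Complex.ofReal_re]
      linarith
    | succ n =>
      rw [hφs]
      exact (hφ₁ n).1
  obtain ⟨ε, hε, L₀, hwin⟩ := hB U hU _ φ hadm (a / 8) (by positivity)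
  -- Step 3: the side
  obtain ⟨k, hkdef⟩ : ∃ k : ℕ, k = L₀ + L₁ + ⌈4 * Real.pi / ε⌉₊ + ⌈128 * Real.pi ^ 2 / a⌉₊ + 3 :=
    ⟨_, rfl⟩
  obtain ⟨n, hndef⟩ : ∃ n : ℕ, n = 2 * k - 1 := ⟨_, rfl⟩
  have hnk : n + 1 = 2 * k := by omega
  have hEven : Even (n + 1) := ⟨k, by omega⟩
  have hL₀ : L₀ ≤ n + 1 := by omega
  have hL₁ : L₁ ≤ n + 1 := by omega
  have hL6 : 6 ≤ n + 1 := by omega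
  have hLr : (0 : ℝ) < ((n + 1 : ℕ) : ℝ) := by positivity
  have hkr : (k : ℝ) ≤ ((n + 1 : ℕ) : ℝ) := by exact_mod_cast (show k ≤ n + 1 by omega)
  have h4π : 4 * Real.pi / ε ≤ ((n + 1 : ℕ) : ℝ) := by
    have h1 := Nat.le_ceil (4 * Real.pi / ε)
    have h2 : ((⌈4 * Real.pi / ε⌉₊ : ℕ) : ℝ) ≤ k := by
      rw [hkdef]; push_cast
      linarith [show (0:ℝ) ≤ L₀ from Nat.cast_nonneg _, show (0:ℝ) ≤ L₁ from Nat.cast_nonneg _,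
        show (0:ℝ) ≤ ⌈128 * Real.pi ^ 2 / a⌉₊ from Nat.cast_nonneg _]
    linarith
  have h128 : 128 * Real.pi ^ 2 / a ≤ ((n + 1 : ℕ) : ℝ) ^ 2 := by
    have h1 := Nat.le_ceil (128 * Real.pi ^ 2 / a)
    have h2 : ((⌈128 * Real.pi ^ 2 / a⌉₊ : ℕ) : ℝ) ≤ k := by
      rw [hkdef]; push_cast
      linarith [show (0:ℝ) ≤ L₀ from Nat.cast_nonneg _, show (0:ℝ) ≤ L₁ from Nat.cast_nonneg _,
        show (0:ℝ) ≤ ⌈4 * Real.pi / ε⌉₊ from Nat.cast_nonneg _]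
    have h1L : (1 : ℝ) ≤ ((n + 1 : ℕ) : ℝ) := by exact_mod_cast (show 1 ≤ n + 1 by omega)
    have h3 : ((n + 1 : ℕ) : ℝ) ≤ ((n + 1 : ℕ) : ℝ) ^ 2 := by nlinarith
    linarith
  -- Step 4: the window of the twisted ground state at side `n + 1`
  have hw := hwin (n + 1) hEven hL₀
  rw [hφs] at hw
  obtain ⟨m₀, hm₀ne, hm₀1, hval, hS⟩ := (hφ₁ n).2 hL₁ hEven hL6
  have hnorm : momentumNormSq (n + 1) m₀ ≤ ε ^ 2 := by
    rw [momentumNormSq_apply, Fin.sum_univ_two, hval, hm₀1, ZMod.valMinAbs_zero, Int.cast_zero]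
    have h1 : 4 * Real.pi ≤ ε * ((n + 1 : ℕ) : ℝ) := by
      rw [div_le_iff₀ hε] at h4π
      linarith
    have h2 : 2 * Real.pi / ((n + 1 : ℕ) : ℝ) * 2 ≤ ε := by
      rw [div_mul_eq_mul_div, div_le_iff₀ hLr]
      linarith
    have h3 : 0 ≤ 2 * Real.pi / ((n + 1 : ℕ) : ℝ) * 2 := by positivity
    have h4 : (2 * Real.pi / ((n + 1 : ℕ) : ℝ)) ^ 2 * (4 + (0 : ℝ) ^ 2) =
        (2 * Real.pi / ((n + 1 : ℕ) : ℝ) * 2) ^ 2 := by ring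
    rw [h4]
    exact pow_le_pow_left₀ h3 h2 2
  have hterm : pairStructureFactor dWaveFormFactor (n + 1) (φ₁ n) m₀ ≤
      ∑ m : TorusSite 2 (n + 1), if m ≠ 0 ∧ momentumNormSq (n + 1) m ≤ ε ^ 2 then
        pairStructureFactor dWaveFormFactor (n + 1) (φ₁ n) m else 0 := by
    have h0 : (if m₀ ≠ 0 ∧ momentumNormSq (n + 1) m₀ ≤ ε ^ 2 then
        pairStructureFactor dWaveFormFactor (n + 1) (φ₁ n) m₀ else 0) =
        pairStructureFactor dWaveFormFactor (n + 1) (φ₁ n) m₀ := if_pos ⟨hm₀ne, hnorm⟩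
    rw [← h0]
    exact Finset.single_le_sum (f := fun m => if m ≠ 0 ∧ momentumNormSq (n + 1) m ≤ ε ^ 2 then
        pairStructureFactor dWaveFormFactor (n + 1) (φ₁ n) m else 0)
      (fun m _ => by
        split_ifs
        · exact pairStructureFactor_nonneg _ _ _ _
        · exact le_rfl)
      (Finset.mem_univ _)
  -- contradiction: `aL²/2 − 32π² ≤ (a/8) L²` while `aL² ≥ 128π²`
  have hlow : 128 * Real.pi ^ 2 ≤ a * ((n + 1 : ℕ) : ℝ) ^ 2 := by
    rw [div_le_iff₀ ha] at h128
    linarith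
  have hπ : 0 < Real.pi ^ 2 := by positivity
  linarith [hS, hterm, hw, hlow, hπ]

end Summit.HubbardSuperconductivity.HubbardSuperconductivity.Theorems.NoInfraredPileUp.Negative
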